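import Mathlib
import HarnessLib
import Summits.AtomisticToContinuum.FouriersLaw.Theses.JunctionLocality
import Literature.MathematicalPhysics.KineticTheory.LangevinChainGibbs

/-!
# Gaussian integration by parts for the probe thermostats of line `thermalise-then-cut-probe-insertion`
# (crux stmt-AtomisticToContinuum-11748; helpers for stub `stub_junctionCurvature`)

The two vocabulary items `thermo`, `junctionOU` are copied VERBATIM from the registered skeleton
`Cruxes/SuperadditiveResistance/Lines/thermalise-then-cut-probe-insertion.lean` (same namespace, same
names). This file's own content (section `ThermoIBP`): the Dirichlet-form identities of the one-site
Ornstein–Uhlenbeck thermostat `thermo L s θ = θ ∂²_{p_s} − p_s ∂_{p_s}` and of the probe-pair operator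
`S_K = junctionOU T N M` against the Gibbs density `e^{-H/T}` / the Gibbs measure `μ_T` of an ARBITRARY
`OscillatorChain` with `C¹` potentials, in the two flavours needed downstream — the twice-differentiated
function compactly supported (`f ∈ C²_c`, `g ∈ C¹`), or the TEST function compactly supported
(`f ∈ C²`, `g ∈ C¹_c`: the form in which the non-compactly-supported classical forward fields
`gb = (−L_dev)⁻¹(p_s² − T)` of `IsForwardField` are tested):

* `integral_ou_mul_gibbsDensity(')` :
  `∫ (θ ∂²_{p_i} f − p_i ∂_{p_i} f) g e^{-H/T} = −θ ∫ ∂_{p_i}f ∂_{p_i}g e^{-H/T} + (θ/T − 1) ∫ p_i ∂_{p_i}f g e^{-H/T}`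
  (second term = fluctuation–dissipation defect of a thermostat at temperature `θ ≠ T`);
* `integral_thermo_mul_gibbsDensity(')` : the same for `thermo L s θ` (site given by its index `s : ℕ`);
* `integral_junctionOU_mul_gibbsMeasure(')` :
  `⟨S_K f, g⟩_{μ_T} = −T Σ_{a ∈ {N−1, N}} ⟨∂_{p_a} f, ∂_{p_a} g⟩_{μ_T}` (`T ≠ 0`);
* `integral_junctionOU_mul_comm` : `⟨S_K f, g⟩_{μ_T} = ⟨S_K g, f⟩_{μ_T}` (`f ∈ C²_c`, `g ∈ C²`);
* `integral_junctionOU_mul_self_nonpos` : `⟨S_K f, f⟩_{μ_T} ≤ 0` (`T > 0`).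

Identities, uniform in `N, M`; proofs are two line-derivative integrations by parts on phase space
(`integral_mul_eq_neg_of_hasLineDerivAt`, `∂_{p_i} e^{-H/T} = −(p_i/T) e^{-H/T}` from
`LangevinChainGibbs`). References: Cuneo–Eckmann–Hairer–Rey-Bellet 2018 §3.1 (proof of Prop. 3.3);
the Ornstein–Uhlenbeck Dirichlet form is folklore.
-/

noncomputable section

open MeasureTheory Filter Topology ProbabilityTheory
open scoped ContDiff NNReal
open Literature.MathematicalPhysics.KineticTheory.HeatConduction

namespace Summit.AtomisticToContinuum.FouriersLaw.Cruxes.SuperadditiveResistance.ThermaliseThenCutProbeInsertion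

/-! ## Vocabulary (verbatim from the registered skeleton) -/

/-- Ornstein–Uhlenbeck thermostat of temperature `θ` (strength 1) acting on the momentum `p_s`:
`θ ∂²_{p_s} f − p_s ∂_{p_s} f`. -/
def thermo (L s : ℕ) (θ : ℝ) (f : PhaseSpace L → ℝ) (x : PhaseSpace L) : ℝ :=
  ∑ i : Fin L, if i.val = s then θ * partialP i (partialP i f) x - x.2 i * partialP i f x else 0

/-- `S_K`: the Ornstein–Uhlenbeck operator (temperature `T`, unit strength) of the probe pair,
acting on the junction momenta `p_{N−1}, p_N`; `μ_T`-symmetric, `≤ 0`, kernel = functions of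
everything but `p_{N−1}, p_N`. The device generator at equilibrium is `L_T + γ S_K`. -/
def junctionOU (T : ℝ) (N M : ℕ) (f : PhaseSpace (N + M) → ℝ) (x : PhaseSpace (N + M)) : ℝ :=
  thermo (N + M) (N - 1) T f x + thermo (N + M) N T f x

/-! ## Gaussian integration by parts for the probe thermostats (this file's own content) -/

section ThermoIBP

variable {L : ℕ}

/-- Product rule along the momentum direction `(0, e_i)`:
`∂_{p_i}(g e^{-H/T}) = (∂_{p_i} g) e^{-H/T} − (p_i/T) g e^{-H/T}` (uses `∂_{p_i} H = p_i`). -/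
theorem hasLineDerivAt_mul_gibbsDensity (P : OscillatorChain) (T : ℝ) {g : PhaseSpace L → ℝ}
    (hg : Differentiable ℝ g) (i : Fin L) (x : PhaseSpace L) :
    HasLineDerivAt ℝ (fun y => g y * P.gibbsDensity L T y)
      (partialP i g x * P.gibbsDensity L T x + g x * (-(x.2 i / T) * P.gibbsDensity L T x)) x
      ((0, Pi.single i 1) : PhaseSpace L) := by
  have h1 := hasLineDerivAt_partialP hg i x
  have h2 := P.hasLineDerivAt_gibbsDensity (T := T) (P.hasLineDerivAt_hamiltonian_unitP L x i)
  unfold HasLineDerivAt at h1 h2 ⊢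
  have h := h1.mul h2
  simp only [zero_smul, add_zero] at h
  exact h

/-- Algebraic core of the one-site identity: from the raw integration by parts
`∫ ∂²_{p_i} f (g ρ) = −∫ ∂_{p_i} f ∂_{p_i}(g ρ)` and integrability of the three pieces. -/
private theorem integral_ou_mul_gibbsDensity_core (P : OscillatorChain) (T θ : ℝ)
    {f g : PhaseSpace L → ℝ} (i : Fin L)
    (intA : Integrable fun x => partialP i (partialP i f) x * (g x * P.gibbsDensity L T x))
    (intB : Integrable fun x => x.2 i * partialP i f x * g x * P.gibbsDensity L T x)
    (intC : Integrable fun x => partialP i f x * partialP i g x * P.gibbsDensity L T x)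
    (e : ∫ x, partialP i (partialP i f) x * (g x * P.gibbsDensity L T x) =
      -∫ x, partialP i f x *
        (partialP i g x * P.gibbsDensity L T x + g x * (-(x.2 i / T) * P.gibbsDensity L T x))) :
    ∫ x, (θ * partialP i (partialP i f) x - x.2 i * partialP i f x) * g x * P.gibbsDensity L T x =
      -θ * (∫ x, partialP i f x * partialP i g x * P.gibbsDensity L T x) +
        (θ / T - 1) * ∫ x, x.2 i * partialP i f x * g x * P.gibbsDensity L T x := by
  have hsplitL : (fun x => (θ * partialP i (partialP i f) x - x.2 i * partialP i f x) * g x *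
      P.gibbsDensity L T x) = fun x => θ * (partialP i (partialP i f) x *
        (g x * P.gibbsDensity L T x)) - x.2 i * partialP i f x * g x * P.gibbsDensity L T x := by
    funext x; ring
  have hsplitR : (fun x => partialP i f x * (partialP i g x * P.gibbsDensity L T x +
      g x * (-(x.2 i / T) * P.gibbsDensity L T x))) = fun x =>
        partialP i f x * partialP i g x * P.gibbsDensity L T x -
          T⁻¹ * (x.2 i * partialP i f x * g x * P.gibbsDensity L T x) := by
    funext x; ring
  have h1 : ∫ x, (θ * partialP i (partialP i f) x - x.2 i * partialP i f x) * g x *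
      P.gibbsDensity L T x = θ * (∫ x, partialP i (partialP i f) x *
        (g x * P.gibbsDensity L T x)) - ∫ x, x.2 i * partialP i f x * g x * P.gibbsDensity L T x := by
    rw [hsplitL, integral_sub (intA.const_mul θ) intB, integral_const_mul]
  have h2 : ∫ x, partialP i f x * (partialP i g x * P.gibbsDensity L T x +
      g x * (-(x.2 i / T) * P.gibbsDensity L T x)) =
        (∫ x, partialP i f x * partialP i g x * P.gibbsDensity L T x) -
          T⁻¹ * ∫ x, x.2 i * partialP i f x * g x * P.gibbsDensity L T x := by
    rw [hsplitR, integral_sub intC (intB.const_mul _), integral_const_mul]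
  rw [h1, e, h2]
  ring

/-- **One-site Gaussian integration by parts, `f` compactly supported.** For an oscillator chain
with `C¹` potentials, `f ∈ C²_c`, `g ∈ C¹`, any site `i`, thermostat temperature `θ` and Gibbs
temperature `T`:
`∫ (θ ∂²_{p_i} f − p_i ∂_{p_i} f) g e^{-H/T} = −θ ∫ ∂_{p_i}f ∂_{p_i}g e^{-H/T} + (θ/T − 1) ∫ p_i ∂_{p_i}f g e^{-H/T}`
(at `θ = T`: the Ornstein–Uhlenbeck operator is `μ_T`-symmetric with Dirichlet form
`T ∫ ∂_{p_i}f ∂_{p_i}g dμ_T`). -/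
theorem integral_ou_mul_gibbsDensity (P : OscillatorChain) (hU : ContDiff ℝ 1 P.U)
    (hV : ContDiff ℝ 1 P.V) (T θ : ℝ) {f g : PhaseSpace L → ℝ} (hf : ContDiff ℝ 2 f)
    (hfc : HasCompactSupport f) (hg : ContDiff ℝ 1 g) (i : Fin L) :
    ∫ x, (θ * partialP i (partialP i f) x - x.2 i * partialP i f x) * g x * P.gibbsDensity L T x =
      -θ * (∫ x, partialP i f x * partialP i g x * P.gibbsDensity L T x) +
        (θ / T - 1) * ∫ x, x.2 i * partialP i f x * g x * P.gibbsDensity L T x := by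
  have hfd : Differentiable ℝ f := hf.differentiable two_ne_zero
  have hgd : Differentiable ℝ g := hg.differentiable one_ne_zero
  have hf1 : ContDiff ℝ 1 (partialP i f) := contDiff_partialP hf (by norm_num) i
  have hf1d : Differentiable ℝ (partialP i f) := hf1.differentiable one_ne_zero
  have hfc1 : HasCompactSupport (partialP i f) := hasCompactSupport_partialP hfd hfc i
  have hfc2 : HasCompactSupport (partialP i (partialP i f)) := hasCompactSupport_partialP hf1d hfc1 i
  have hfC1 : Continuous (partialP i f) := hf1.continuous
  have hfC2 : Continuous (partialP i (partialP i f)) := continuous_partialP hf1 one_ne_zero i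
  have hgC : Continuous g := hg.continuous
  have hgC1 : Continuous (partialP i g) := continuous_partialP hg one_ne_zero i
  have hρc : Continuous (P.gibbsDensity L T) :=
    P.continuous_gibbsDensity hU.continuous hV.continuous L T
  refine integral_ou_mul_gibbsDensity_core P T θ i
    ((hfC2.mul (hgC.mul hρc)).integrable_of_hasCompactSupport hfc2.mul_right)
    (Continuous.integrable_of_hasCompactSupport (by fun_prop)
      ((hfc1.mul_left (f := fun x : PhaseSpace L => x.2 i)).mul_right).mul_right)
    (Continuous.integrable_of_hasCompactSupport (by fun_prop) (hfc1.mul_right).mul_right) ?_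
  -- ∫ (g ρ) ∂²f = -∫ ∂(g ρ) ∂f, derivative moved off the compactly supported factor ∂f
  have e := integral_mul_eq_neg_of_hasLineDerivAt (v := ((0, Pi.single i 1) : PhaseSpace L))
    (hgC.mul hρc) (by fun_prop) hfC1 hfC2 hfc1 hfc2
    (fun x => hasLineDerivAt_mul_gibbsDensity P T hgd i x) (fun x => hasLineDerivAt_partialP hf1d i x)
  rw [← integral_neg] at e ⊢
  refine Eq.trans (integral_congr_ae (Filter.Eventually.of_forall fun x => ?_))
    (e.trans (integral_congr_ae (Filter.Eventually.of_forall fun x => ?_)))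
  · show _ = g x * P.gibbsDensity L T x * partialP i (partialP i f) x; ring
  · show -(_ * partialP i f x) = _; ring

/-- **One-site Gaussian integration by parts, test function compactly supported.** Same identity
as `integral_ou_mul_gibbsDensity` for `f ∈ C²` WITHOUT support condition and `g ∈ C¹_c`. -/
theorem integral_ou_mul_gibbsDensity' (P : OscillatorChain) (hU : ContDiff ℝ 1 P.U)
    (hV : ContDiff ℝ 1 P.V) (T θ : ℝ) {f g : PhaseSpace L → ℝ} (hf : ContDiff ℝ 2 f)
    (hg : ContDiff ℝ 1 g) (hgc : HasCompactSupport g) (i : Fin L) :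
    ∫ x, (θ * partialP i (partialP i f) x - x.2 i * partialP i f x) * g x * P.gibbsDensity L T x =
      -θ * (∫ x, partialP i f x * partialP i g x * P.gibbsDensity L T x) +
        (θ / T - 1) * ∫ x, x.2 i * partialP i f x * g x * P.gibbsDensity L T x := by
  have hgd : Differentiable ℝ g := hg.differentiable one_ne_zero
  have hf1 : ContDiff ℝ 1 (partialP i f) := contDiff_partialP hf (by norm_num) i
  have hf1d : Differentiable ℝ (partialP i f) := hf1.differentiable one_ne_zero
  have hfC1 : Continuous (partialP i f) := hf1.continuous
  have hfC2 : Continuous (partialP i (partialP i f)) := continuous_partialP hf1 one_ne_zero i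
  have hgC : Continuous g := hg.continuous
  have hgC1 : Continuous (partialP i g) := continuous_partialP hg one_ne_zero i
  have hgc1 : HasCompactSupport (partialP i g) := hasCompactSupport_partialP hgd hgc i
  have hρc : Continuous (P.gibbsDensity L T) :=
    P.continuous_gibbsDensity hU.continuous hV.continuous L T
  refine integral_ou_mul_gibbsDensity_core P T θ i
    ((hfC2.mul (hgC.mul hρc)).integrable_of_hasCompactSupport (hgc.mul_right).mul_left)
    (Continuous.integrable_of_hasCompactSupport (by fun_prop) (hgc.mul_left).mul_right)
    (Continuous.integrable_of_hasCompactSupport (by fun_prop) (hgc1.mul_left).mul_right) ?_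
  -- ∫ ∂f ∂(g ρ) = -∫ ∂²f (g ρ), derivative moved onto ∂f off the compactly supported g ρ
  have e : ∫ x, partialP i f x *
      (partialP i g x * P.gibbsDensity L T x + g x * (-(x.2 i / T) * P.gibbsDensity L T x)) =
        -∫ x, partialP i (partialP i f) x * (g x * P.gibbsDensity L T x) := by
    apply integral_mul_eq_neg_of_hasLineDerivAt (v := ((0, Pi.single i 1) : PhaseSpace L))
      hfC1 hfC2 (hgC.mul hρc) (by fun_prop) hgc.mul_right
    · exact (hgc1.mul_right).add (hgc.mul_right)
    · exact fun x => hasLineDerivAt_partialP hf1d i x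
    · exact fun x => hasLineDerivAt_mul_gibbsDensity P T hgd i x
  rw [e, neg_neg]

/-- From the one-site identity at every site to `thermo L s θ` (the sum over `i` with `i.val = s`
has at most one non-zero term; it is empty if `s ≥ L`). -/
private theorem integral_thermo_mul_gibbsDensity_core (P : OscillatorChain) (s : ℕ) (T θ : ℝ)
    {f g : PhaseSpace L → ℝ}
    (hint : ∀ i : Fin L, i.val = s → Integrable fun x =>
      (θ * partialP i (partialP i f) x - x.2 i * partialP i f x) * g x * P.gibbsDensity L T x)
    (hval : ∀ i : Fin L, ∫ x, (θ * partialP i (partialP i f) x - x.2 i * partialP i f x) * g x *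
      P.gibbsDensity L T x = -θ * (∫ x, partialP i f x * partialP i g x * P.gibbsDensity L T x) +
        (θ / T - 1) * ∫ x, x.2 i * partialP i f x * g x * P.gibbsDensity L T x) :
    (Integrable fun x => thermo L s θ f x * g x * P.gibbsDensity L T x) ∧
    ∫ x, thermo L s θ f x * g x * P.gibbsDensity L T x =
      ∑ i : Fin L, if i.val = s then
        -θ * (∫ x, partialP i f x * partialP i g x * P.gibbsDensity L T x) +
          (θ / T - 1) * ∫ x, x.2 i * partialP i f x * g x * P.gibbsDensity L T x else 0 := by
  have hterm : ∀ i : Fin L, Integrable fun x => (if i.val = s then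
      θ * partialP i (partialP i f) x - x.2 i * partialP i f x else 0) * g x *
        P.gibbsDensity L T x := by
    intro i
    by_cases h : i.val = s
    · simp only [h, if_true]; exact hint i h
    · simp only [h, if_false, zero_mul]; exact integrable_zero _ _ _
  have hsplit : (fun x => thermo L s θ f x * g x * P.gibbsDensity L T x) = fun x =>
      ∑ i : Fin L, (if i.val = s then
        θ * partialP i (partialP i f) x - x.2 i * partialP i f x else 0) * g x *
          P.gibbsDensity L T x := by
    funext x; simp only [thermo, Finset.sum_mul]
  rw [hsplit, integral_finsetSum _ fun i _ => hterm i]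
  refine ⟨integrable_finsetSum _ fun i _ => hterm i, Finset.sum_congr rfl fun i _ => ?_⟩
  by_cases h : i.val = s
  · simp only [h, if_true]; exact hval i
  · simp only [h, if_false, zero_mul, integral_zero]

/-- **`thermo L s θ` against the Gibbs density, `f ∈ C²_c`, `g ∈ C¹`** (and integrability of the
integrand). -/
theorem integral_thermo_mul_gibbsDensity (P : OscillatorChain) (hU : ContDiff ℝ 1 P.U)
    (hV : ContDiff ℝ 1 P.V) (s : ℕ) (T θ : ℝ) {f g : PhaseSpace L → ℝ} (hf : ContDiff ℝ 2 f)
    (hfc : HasCompactSupport f) (hg : ContDiff ℝ 1 g) :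
    (Integrable fun x => thermo L s θ f x * g x * P.gibbsDensity L T x) ∧
    ∫ x, thermo L s θ f x * g x * P.gibbsDensity L T x =
      ∑ i : Fin L, if i.val = s then
        -θ * (∫ x, partialP i f x * partialP i g x * P.gibbsDensity L T x) +
          (θ / T - 1) * ∫ x, x.2 i * partialP i f x * g x * P.gibbsDensity L T x else 0 := by
  refine integral_thermo_mul_gibbsDensity_core P s T θ (fun i _ => ?_)
    fun i => integral_ou_mul_gibbsDensity P hU hV T θ hf hfc hg i
  have hfd : Differentiable ℝ f := hf.differentiable two_ne_zero
  have hf1 : ContDiff ℝ 1 (partialP i f) := contDiff_partialP hf (by norm_num) i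
  have hfc1 : HasCompactSupport (partialP i f) := hasCompactSupport_partialP hfd hfc i
  have hfc2 : HasCompactSupport (partialP i (partialP i f)) :=
    hasCompactSupport_partialP (hf1.differentiable one_ne_zero) hfc1 i
  have hfC1 : Continuous (partialP i f) := hf1.continuous
  have hfC2 : Continuous (partialP i (partialP i f)) := continuous_partialP hf1 one_ne_zero i
  have hgC : Continuous g := hg.continuous
  have hρc : Continuous (P.gibbsDensity L T) :=
    P.continuous_gibbsDensity hU.continuous hV.continuous L T
  refine Continuous.integrable_of_hasCompactSupport (by fun_prop) ?_
  exact (((hfc2.mul_left).sub (hfc1.mul_left)).mul_right).mul_right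

/-- **`thermo L s θ` against the Gibbs density, `f ∈ C²`, `g ∈ C¹_c`.** -/
theorem integral_thermo_mul_gibbsDensity' (P : OscillatorChain) (hU : ContDiff ℝ 1 P.U)
    (hV : ContDiff ℝ 1 P.V) (s : ℕ) (T θ : ℝ) {f g : PhaseSpace L → ℝ} (hf : ContDiff ℝ 2 f)
    (hg : ContDiff ℝ 1 g) (hgc : HasCompactSupport g) :
    (Integrable fun x => thermo L s θ f x * g x * P.gibbsDensity L T x) ∧
    ∫ x, thermo L s θ f x * g x * P.gibbsDensity L T x =
      ∑ i : Fin L, if i.val = s then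
        -θ * (∫ x, partialP i f x * partialP i g x * P.gibbsDensity L T x) +
          (θ / T - 1) * ∫ x, x.2 i * partialP i f x * g x * P.gibbsDensity L T x else 0 := by
  refine integral_thermo_mul_gibbsDensity_core P s T θ (fun i _ => ?_)
    fun i => integral_ou_mul_gibbsDensity' P hU hV T θ hf hg hgc i
  have hf1 : ContDiff ℝ 1 (partialP i f) := contDiff_partialP hf (by norm_num) i
  have hfC1 : Continuous (partialP i f) := hf1.continuous
  have hfC2 : Continuous (partialP i (partialP i f)) := continuous_partialP hf1 one_ne_zero i
  have hgC : Continuous g := hg.continuous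
  have hρc : Continuous (P.gibbsDensity L T) :=
    P.continuous_gibbsDensity hU.continuous hV.continuous L T
  exact Continuous.integrable_of_hasCompactSupport (by fun_prop) ((hgc.mul_left).mul_right)

/-! ### The probe-pair operator `S_K = junctionOU T N M` against the Gibbs measure -/

/-- Assembly of the two probe sites (common to both flavours). -/
private theorem integral_junctionOU_mul_gibbsDensity_core (P : OscillatorChain) {T : ℝ}
    (hT : T ≠ 0) (N M : ℕ) {f g : PhaseSpace (N + M) → ℝ}
    (hth : ∀ s : ℕ, (Integrable fun x => thermo (N + M) s T f x * g x * P.gibbsDensity (N + M) T x) ∧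
      ∫ x, thermo (N + M) s T f x * g x * P.gibbsDensity (N + M) T x =
      ∑ i : Fin (N + M), if i.val = s then
        -T * (∫ x, partialP i f x * partialP i g x * P.gibbsDensity (N + M) T x) +
          (T / T - 1) * ∫ x, x.2 i * partialP i f x * g x * P.gibbsDensity (N + M) T x else 0)
    (hintC : ∀ i : Fin (N + M),
      Integrable fun x => partialP i f x * partialP i g x * P.gibbsDensity (N + M) T x) :
    ∫ x, junctionOU T N M f x * g x * P.gibbsDensity (N + M) T x =
      -T * ∫ x, ((∑ i : Fin (N + M), if i.val = N - 1 then partialP i f x * partialP i g x else 0) +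
        (∑ i : Fin (N + M), if i.val = N then partialP i f x * partialP i g x else 0)) *
          P.gibbsDensity (N + M) T x := by
  have hTT : T / T - 1 = 0 := by rw [div_self hT, sub_self]
  simp only [hTT, zero_mul, add_zero] at hth
  have hL : (fun x => junctionOU T N M f x * g x * P.gibbsDensity (N + M) T x) = fun x =>
      thermo (N + M) (N - 1) T f x * g x * P.gibbsDensity (N + M) T x +
        thermo (N + M) N T f x * g x * P.gibbsDensity (N + M) T x := by
    funext x; simp only [junctionOU]; ring
  have hterm : ∀ (s : ℕ) (i : Fin (N + M)), Integrable fun x =>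
      (if i.val = s then partialP i f x * partialP i g x else 0) * P.gibbsDensity (N + M) T x := by
    intro s i
    by_cases h : i.val = s
    · simp only [h, if_true]; exact hintC i
    · simp only [h, if_false, zero_mul]; exact integrable_zero _ _ _
  have hval : ∀ (s : ℕ) (i : Fin (N + M)),
      ∫ x, (if i.val = s then partialP i f x * partialP i g x else 0) * P.gibbsDensity (N + M) T x =
        if i.val = s then ∫ x, partialP i f x * partialP i g x * P.gibbsDensity (N + M) T x
          else 0 := by
    intro s i
    by_cases h : i.val = s
    · simp only [h, if_true]
    · simp only [h, if_false, zero_mul, integral_zero]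
  have hR : (fun x => ((∑ i : Fin (N + M), if i.val = N - 1 then partialP i f x * partialP i g x
      else 0) + (∑ i : Fin (N + M), if i.val = N then partialP i f x * partialP i g x else 0)) *
        P.gibbsDensity (N + M) T x) = fun x =>
      (∑ i : Fin (N + M), (if i.val = N - 1 then partialP i f x * partialP i g x else 0) *
        P.gibbsDensity (N + M) T x) +
      ∑ i : Fin (N + M), (if i.val = N then partialP i f x * partialP i g x else 0) *
        P.gibbsDensity (N + M) T x := by
    funext x; simp only [add_mul, Finset.sum_mul]
  rw [hL, integral_add (hth _).1 (hth _).1, (hth _).2, (hth _).2, hR,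
    integral_add (integrable_finsetSum _ fun i _ => hterm _ i)
      (integrable_finsetSum _ fun i _ => hterm _ i),
    integral_finsetSum _ fun i _ => hterm _ i, integral_finsetSum _ fun i _ => hterm _ i]
  simp only [hval]
  rw [mul_add, Finset.mul_sum, Finset.mul_sum]
  congr 1 <;>
  · refine Finset.sum_congr rfl fun i _ => ?_
    split_ifs <;> simp

/-- **Dirichlet form of the probe pair, `f ∈ C²_c`, `g ∈ C¹`** (`T ≠ 0`):
`⟨S_K f, g⟩_{μ_T} = −T Σ_{a ∈ {N−1, N}} ⟨∂_{p_a} f, ∂_{p_a} g⟩_{μ_T}` for the Gibbs measure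
`μ_T = Z⁻¹ e^{-H/T} dq dp` of any chain with `C¹` potentials (both sides are the junk `0` if
`e^{-H/T}` is not integrable). -/
theorem integral_junctionOU_mul_gibbsMeasure (P : OscillatorChain) (hU : ContDiff ℝ 1 P.U)
    (hV : ContDiff ℝ 1 P.V) {T : ℝ} (hT : T ≠ 0) (N M : ℕ) {f g : PhaseSpace (N + M) → ℝ}
    (hf : ContDiff ℝ 2 f) (hfc : HasCompactSupport f) (hg : ContDiff ℝ 1 g) :
    ∫ x, junctionOU T N M f x * g x ∂(P.gibbsMeasure (N + M) T) =
      -T * ∫ x, ((∑ i : Fin (N + M), if i.val = N - 1 then partialP i f x * partialP i g x else 0) +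
        (∑ i : Fin (N + M), if i.val = N then partialP i f x * partialP i g x else 0))
          ∂(P.gibbsMeasure (N + M) T) := by
  rw [P.integral_gibbsMeasure, P.integral_gibbsMeasure,
    integral_junctionOU_mul_gibbsDensity_core P hT N M
      (fun s => integral_thermo_mul_gibbsDensity P hU hV s T T hf hfc hg) fun i => ?_]
  · ring
  have hfC1 : Continuous (partialP i f) := continuous_partialP hf two_ne_zero i
  have hgC1 : Continuous (partialP i g) := continuous_partialP hg one_ne_zero i
  have hρc : Continuous (P.gibbsDensity (N + M) T) :=
    P.continuous_gibbsDensity hU.continuous hV.continuous (N + M) T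
  exact Continuous.integrable_of_hasCompactSupport (by fun_prop)
    ((hasCompactSupport_partialP (hf.differentiable two_ne_zero) hfc i).mul_right).mul_right

/-- **Dirichlet form of the probe pair, `f ∈ C²`, `g ∈ C¹_c`** (`T ≠ 0`). -/
theorem integral_junctionOU_mul_gibbsMeasure' (P : OscillatorChain) (hU : ContDiff ℝ 1 P.U)
    (hV : ContDiff ℝ 1 P.V) {T : ℝ} (hT : T ≠ 0) (N M : ℕ) {f g : PhaseSpace (N + M) → ℝ}
    (hf : ContDiff ℝ 2 f) (hg : ContDiff ℝ 1 g) (hgc : HasCompactSupport g) :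
    ∫ x, junctionOU T N M f x * g x ∂(P.gibbsMeasure (N + M) T) =
      -T * ∫ x, ((∑ i : Fin (N + M), if i.val = N - 1 then partialP i f x * partialP i g x else 0) +
        (∑ i : Fin (N + M), if i.val = N then partialP i f x * partialP i g x else 0))
          ∂(P.gibbsMeasure (N + M) T) := by
  rw [P.integral_gibbsMeasure, P.integral_gibbsMeasure,
    integral_junctionOU_mul_gibbsDensity_core P hT N M
      (fun s => integral_thermo_mul_gibbsDensity' P hU hV s T T hf hg hgc) fun i => ?_]
  · ring
  have hfC1 : Continuous (partialP i f) := continuous_partialP hf two_ne_zero i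
  have hgC1 : Continuous (partialP i g) := continuous_partialP hg one_ne_zero i
  have hρc : Continuous (P.gibbsDensity (N + M) T) :=
    P.continuous_gibbsDensity hU.continuous hV.continuous (N + M) T
  exact Continuous.integrable_of_hasCompactSupport (by fun_prop)
    ((hasCompactSupport_partialP (hg.differentiable one_ne_zero) hgc i).mul_left).mul_right

/-- **`S_K` is `μ_T`-symmetric**: `⟨S_K f, g⟩_{μ_T} = ⟨S_K g, f⟩_{μ_T}` for `f ∈ C²_c`, `g ∈ C²`
(`T ≠ 0`: the thermostat temperature of `S_K` equals the Gibbs temperature). -/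
theorem integral_junctionOU_mul_comm :
    ∀ (P : OscillatorChain), ContDiff ℝ 1 P.U → ContDiff ℝ 1 P.V → ∀ {T : ℝ}, T ≠ 0 →
      ∀ (N M : ℕ) {f g : PhaseSpace (N + M) → ℝ}, ContDiff ℝ 2 f → HasCompactSupport f →
        ContDiff ℝ 2 g →
        ∫ x, junctionOU T N M f x * g x ∂(P.gibbsMeasure (N + M) T) =
          ∫ x, junctionOU T N M g x * f x ∂(P.gibbsMeasure (N + M) T) := by
  intro P hU hV T hT N M f g hf hfc hg
  rw [integral_junctionOU_mul_gibbsMeasure P hU hV hT N M hf hfc (hg.of_le (by norm_num)),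
    integral_junctionOU_mul_gibbsMeasure' P hU hV hT N M hg (hf.of_le (by norm_num)) hfc]
  congr 1
  refine integral_congr_ae (Filter.Eventually.of_forall fun x => ?_)
  simp only [mul_comm (partialP _ f x) (partialP _ g x)]

/-- **`S_K` is non-positive**: `⟨S_K f, f⟩_{μ_T} = −T Σ_{a ∈ {N−1,N}} ‖∂_{p_a} f‖²_{μ_T} ≤ 0` for
`f ∈ C²_c`, `T > 0`. -/
theorem integral_junctionOU_mul_self_nonpos (P : OscillatorChain) (hU : ContDiff ℝ 1 P.U)
    (hV : ContDiff ℝ 1 P.V) {T : ℝ} (hT : 0 < T) (N M : ℕ) {f : PhaseSpace (N + M) → ℝ}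
    (hf : ContDiff ℝ 2 f) (hfc : HasCompactSupport f) :
    ∫ x, junctionOU T N M f x * f x ∂(P.gibbsMeasure (N + M) T) ≤ 0 := by
  rw [integral_junctionOU_mul_gibbsMeasure P hU hV hT.ne' N M hf hfc (hf.of_le (by norm_num))]
  have hnn : 0 ≤ ∫ x, ((∑ i : Fin (N + M), if i.val = N - 1 then
      partialP i f x * partialP i f x else 0) + (∑ i : Fin (N + M), if i.val = N then
        partialP i f x * partialP i f x else 0)) ∂(P.gibbsMeasure (N + M) T) := by
    refine integral_nonneg fun x => add_nonneg (Finset.sum_nonneg fun i _ => ?_)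
      (Finset.sum_nonneg fun i _ => ?_) <;>
    · split_ifs
      · exact mul_self_nonneg _
      · exact le_rfl
  nlinarith

end ThermoIBP

end Summit.AtomisticToContinuum.FouriersLaw.Cruxes.SuperadditiveResistance.ThermaliseThenCutProbeInsertion

end
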